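import Summits.CriticalPhenomena.CardyFormulaZ2.Theses.CardySelfDualSegment
import Summits.CriticalPhenomena.CardyFormulaZ2.Theorems.CardyMagicRigidityLoopsToCrossingsStubComparisonGeometry
import Summits.CriticalPhenomena.CardyFormulaZ2.Theorems.CardyMagicRigidityLoopsToCrossingsStubCardyContinuity
import Literature.Probability.Percolation.CornerPercolation
import Literature.Probability.Percolation.CardyFormulaConformalInvariance
import Literature.Probability.Percolation.TriCrossingSandwich
import Literature.Probability.LatticeModels.TriangularLatticeProofs
import Literature.Probability.RandomPlanarGeometry.ImageUnivalent
import Literature.Probability.RandomPlanarGeometry.CollarGeometry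
import Literature.Barriers.CriticalPhenomena.EmbeddingModulusUniquenessProofs

/-!
# Crux `SmirnovBasePoint` (stmt-CriticalPhenomena-5474), line `Sketch`: stub `stub_squeeze`

The analytic squeeze of the sheared two-quad oracle sandwich. A family `pr : ℝ → ℝ` of
"probabilities" attached to a conformal rectangle `R` is assumed to

* dominate, for small mesh `δ`, Smirnov's G02 crossing probability `triDomainCrossingProb Q δ` of
  every comparison quad `Q` in *lower* sandwich position w.r.t. `R` (room `r`, margins `m`, `t`);
* be dominated, for small mesh, by `triDomainCrossingProb N δ` for every comparison quad `N` in
  *upper* sandwich position.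

Given moreover a provider of upper quads `N` arbitrarily close to `R` (parametrised boundaries and
marks within any `ε₀ > 0`, contact depth any `τ > 0`), we conclude `pr δ → F(η_R)` as `δ → 0⁺`:
for `a < F(η_R)` (resp. `F(η_R) < b`) pick the closeness budget `ε₀` of
`OracleSandwich.stub_cardyContinuity` (continuity of the conformal modulus, Radó) for the tolerance
`(F(η_R) - a)/2` (resp. `(b - F(η_R))/2`), a lower quad `Q` from `OracleSandwich.exists_lowerQuad`
(resp. an upper quad `N` from the provider) at contact depth `t = ε/3`, `ε` the distance between
the opposite arcs `(ab)`, `(cd)` of `R`, and a uniformizing datum of the quad; Smirnov's theorem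
(`hasCrossingLimit_triDomainCrossingProb_holds`) on the quad gives
`triDomainCrossingProb Q δ → F(η_Q) > a` (resp. `triDomainCrossingProb N δ → F(η_N) < b`), and the
domination hypotheses transfer the bound to `pr δ` for small `δ`.

Sources: Bollobás–Riordan (2006), Ch. 7 (proof of Thm. 10 from Lemma 14, p. 195); Smirnov (2001), §2.
-/

noncomputable section

namespace Summit.CriticalPhenomena.CardyFormulaZ2.Cruxes.SmirnovBasePoint.ShearedSandwich

open Literature.Probability.RandomPlanarGeometry hiding cardyFunction
open Literature.Probability.Percolation hiding cardyFunction
open Literature.Probability.LatticeModels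
open Literature.Barriers.CriticalPhenomena
open Summit.CriticalPhenomena.CardyFormulaZ2.Cruxes.LoopsToCrossings.OracleSandwich
open Filter Topology Set MeasureTheory Metric

/-- **Stub E1 (the squeeze).** Given the upper-quad provider (stub C): if a family `pr` dominates,
for small mesh, the G02 crossing probability of every comparison quad in lower sandwich position
and is dominated by that of every upper comparison quad, then `pr δ → F(η_R)`: Smirnov's theorem
on the quads (`hasCrossingLimit_triDomainCrossingProb_holds`), `OracleSandwich.exists_lowerQuad`,
and `OracleSandwich.stub_cardyContinuity` (Radó) for the room, as in `crudeToCanonical_proof`.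
[cite: BollobasRiordan2006, Ch. 7 Lemma 14 p. 184 and remark p. 195]
[cite: Smirnov2001, §2] -/
theorem stub_squeeze :
    (∀ (R : ConformalRectangle) (ε₀ τ : ℝ), 0 < ε₀ → 0 < τ →
      ∃ (N : ConformalRectangle) (r m : ℝ), 0 < r ∧ 0 < m ∧
        (∀ u : ℝ, dist (N.boundary u) (R.boundary u) ≤ ε₀) ∧
        (∀ i : Fin 4, |N.mark i - R.mark i| ≤ ε₀) ∧
        (∀ z ∈ N.arc 1 ∪ N.arc 3, ∀ w ∈ R.carrier, r ≤ dist z w) ∧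
        (∀ z ∈ R.carrier, z ∉ N.carrier → infDist z (R.arc 0) ≤ τ ∨ infDist z (R.arc 2) ≤ τ) ∧
        (∀ z ∈ N.carrier, z ∈ R.carrier → m ≤ infDist z (R.arc 0) ∧ m ≤ infDist z (R.arc 2)) ∧
        (∀ z ∈ N.arc 0, infDist z (R.arc 0) ≤ τ) ∧
        (∀ z ∈ N.arc 2, infDist z (R.arc 2) ≤ τ)) →
    ∀ (R : ConformalRectangle) (pr : ℝ → ℝ),
      (∀ (Q : ConformalRectangle) (r m t : ℝ), 0 < r → 0 < m → 0 < t →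
        (∀ p ∈ R.arc 0, ∀ q ∈ R.arc 2, 3 * t < dist p q) →
        (∀ z ∈ cthickening r Q.carrier, z ∉ R.carrier → infDist z (R.arc 0) ≤ t ∨ infDist z (R.arc 2) ≤ t) →
        (∀ z ∈ cthickening r Q.carrier, z ∈ R.carrier → m ≤ infDist z (R.arc 1) ∧ m ≤ infDist z (R.arc 3)) →
        (∀ z ∈ cthickening r (Q.arc 0), z ∉ R.carrier ∧ infDist z (R.arc 0) ≤ t) →
        (∀ z ∈ cthickening r (Q.arc 2), z ∉ R.carrier ∧ infDist z (R.arc 2) ≤ t) →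
        ∃ δ₀ > 0, ∀ δ : ℝ, 0 < δ → δ < δ₀ → triDomainCrossingProb Q δ ≤ pr δ) →
      (∀ (N : ConformalRectangle) (r m τ : ℝ), 0 < r → 0 < m → 0 < τ →
        (∀ p ∈ R.arc 0, ∀ q ∈ R.arc 2, 3 * τ < dist p q) →
        (∀ z ∈ N.arc 1 ∪ N.arc 3, ∀ w ∈ R.carrier, r ≤ dist z w) →
        (∀ z ∈ R.carrier, z ∉ N.carrier → infDist z (R.arc 0) ≤ τ ∨ infDist z (R.arc 2) ≤ τ) →
        (∀ z ∈ N.carrier, z ∈ R.carrier → m ≤ infDist z (R.arc 0) ∧ m ≤ infDist z (R.arc 2)) →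
        (∀ z ∈ N.arc 0, infDist z (R.arc 0) ≤ τ) →
        (∀ z ∈ N.arc 2, infDist z (R.arc 2) ≤ τ) →
        ∃ δ₀ > 0, ∀ δ : ℝ, 0 < δ → δ < δ₀ → pr δ ≤ triDomainCrossingProb N δ) →
      R.HasCrossingLimit pr Literature.Probability.RandomPlanarGeometry.cardyFunction := by
  intro hgeom R pr hlow hup φ x hφ
  set L := Literature.Probability.RandomPlanarGeometry.cardyFunction (crossRatio x) with hL
  have hpos : ∀ᶠ δ in 𝓝[>] (0 : ℝ), 0 < δ := self_mem_nhdsWithin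
  -- separation of the opposite arcs `(ab)`, `(cd)` of `R`
  obtain ⟨ε, hε, hεd⟩ := R.exists_pos_forall_lt_dist_arc
  have hsep : ∀ p ∈ R.arc 0, ∀ q ∈ R.arc 2, 3 * (ε / 3) < dist p q :=
    fun p hp q hq => by linarith [hεd p hp q hq]
  refine tendsto_order.2 ⟨fun a ha => ?_, fun b hb => ?_⟩
  · -- lower half: a lower comparison quad `Q`
    obtain ⟨ε₀, hε₀, hcont⟩ := stub_cardyContinuity R φ x hφ ((L - a) / 2) (by linarith)
    obtain ⟨m, hm, hquad⟩ := exists_lowerQuad R hε₀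
    obtain ⟨Q, r, hr, hQb, hQm, c1, c2, c3, c4⟩ := hquad (ε / 3) (by positivity)
    obtain ⟨ψ, y, hψ⟩ := MarkedDomain.exists_isUniformizing_holds Q
    have hclose := hcont Q hQb hQm ψ y hψ
    have hQlim := hasCrossingLimit_triDomainCrossingProb_holds Q ψ y hψ
    have ha' : a < Literature.Probability.RandomPlanarGeometry.cardyFunction (crossRatio y) := by
      have := (abs_le.1 hclose).1
      linarith
    obtain ⟨δ₀, hδ₀, hdom⟩ := hlow Q r m (ε / 3) hr hm (by positivity) hsep c1 c2 c3 c4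
    have hev1 : ∀ᶠ δ in 𝓝[>] (0 : ℝ), a < triDomainCrossingProb Q δ :=
      (tendsto_order.1 hQlim).1 a ha'
    have hev2 : ∀ᶠ δ in 𝓝[>] (0 : ℝ), δ < δ₀ := mem_nhdsWithin_of_mem_nhds (Iio_mem_nhds hδ₀)
    filter_upwards [hpos, hev1, hev2] with δ hδ h1 h2
    exact h1.trans_le (hdom δ hδ h2)
  · -- upper half: an upper comparison quad `N`
    obtain ⟨ε₀, hε₀, hcont⟩ := stub_cardyContinuity R φ x hφ ((b - L) / 2) (by linarith)
    obtain ⟨N, r, m, hr, hm, hNb, hNm, cb, cc, cd, cf0, cf2⟩ := hgeom R ε₀ (ε / 3) hε₀ (by positivity)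
    obtain ⟨ψ, y, hψ⟩ := MarkedDomain.exists_isUniformizing_holds N
    have hclose := hcont N hNb hNm ψ y hψ
    have hNlim := hasCrossingLimit_triDomainCrossingProb_holds N ψ y hψ
    have hb' : Literature.Probability.RandomPlanarGeometry.cardyFunction (crossRatio y) < b := by
      have := (abs_le.1 hclose).2
      linarith
    obtain ⟨δ₀, hδ₀, hdom⟩ := hup N r m (ε / 3) hr hm (by positivity) hsep cb cc cd cf0 cf2
    have hev1 : ∀ᶠ δ in 𝓝[>] (0 : ℝ), triDomainCrossingProb N δ < b :=
      (tendsto_order.1 hNlim).2 b hb'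
    have hev2 : ∀ᶠ δ in 𝓝[>] (0 : ℝ), δ < δ₀ := mem_nhdsWithin_of_mem_nhds (Iio_mem_nhds hδ₀)
    filter_upwards [hpos, hev1, hev2] with δ hδ h1 h2
    exact (hdom δ hδ h2).trans_lt h1

end Summit.CriticalPhenomena.CardyFormulaZ2.Cruxes.SmirnovBasePoint.ShearedSandwich
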